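import Summits.CriticalPhenomena.PercolationContinuityZ3.Theorems.PercAnnulusCrossingIICScheme
import Summits.CriticalPhenomena.PercolationContinuityZ3.Theorems.PercAnnulusCrossingIICSchemeScales
import Summits.CriticalPhenomena.PercolationContinuityZ3.Theorems.PercAnnulusCrossingIICSchemeSupersolution
import Summits.CriticalPhenomena.PercolationContinuityZ3.Theorems.PercAnnulusCrossingIICTop
import Summits.CriticalPhenomena.PercolationContinuityZ3.Theorems.PercAnnulusCrossingBoxCrossingDefs
import Literature.Barriers.CriticalPhenomena.LaceExpansionPcTriangleLargeD
import HarnessLib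

/-!
# Kesten's incipient infinite cluster exists under (A2)□ — Basu–Sapozhnikov's Theorem 1.1 in boxes, at `p_c(ℤ^d)` (lane RSW3, p1 gen 3)

builds on p205010 (kernel theorem, internal audit signed; external expert review pending)

Seat `prim-rsw3-p1` (gen 3); LANE-4 blueprint, memo `run/shared/lean/prim/rsw3/P1-QM.md` §13.4 — the assembly (step (4)).  Helper
file; no definitions, no sorries.  Parts I–XIX (`PercAnnulusCrossingIIC*.lean`) supply: the one-level decomposition with hole and source and
its junk (θ(p) = 0 and (A2)□), the inward exploration and the factorisation of the kernel, Kesten's cross-ratio condition `≤ ϰ⁻²`, the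
hypotheses of `Literature.Analysis.Convexity.KestenRatioScheme.kesten_multilevel_osc_le`, scales with small junk, a supersolution of
Kesten's recursion close to `1`, and the top level.  Here they are put together:
* **`kestenIICExistsAt_of_setToSetQuasiMultAt`** — for `d ≥ 1`, `0 < p`, `θ(p) = 0` and (A2)□(ϰ) (`SetToSetQuasiMultAt d p ϰ`, `ϰ > 0`):
  `KestenIICExistsAt d p` — for every cylinder event `E` the limit `lim_n P_p(E ∩ {0 ↔ ∂Λ(n)}) / π_p(n)` exists (the ratio sequence is
  Cauchy: `|r(n) − r(n')| ≤ 2ε + (Q_L − 1)`);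
* **`kestenIICExistsAt_criticalProbI_of_setToSetQuasiMultAt`** — at `p = p_c(ℤ^d)`, `d ≥ 2` (`θ(p_c) = 0` by
  `CSH.percolationContinuity_allDimensions`): (A2)□ ⇒ Kesten's IIC exists.  This is D. Basu, A. Sapozhnikov, ECP 22 (2017) Thm. 1.1 for
  Bernoulli percolation at criticality, with their hypothesis (A1) replaced by `θ(p_c) = 0`, in kernel-checked form.
References: H. Kesten, PTRF 73 (1986) Thm. (3); D. Basu, A. Sapozhnikov, ECP 22 (2017) no. 26, Thm. 1.1, §2.
-/

noncomputable section

namespace Summit.CriticalPhenomena.PercolationContinuityZ3.Theorems.Crossing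

open MeasureTheory Literature.Probability.Percolation Literature.Probability.LatticeModels
open Literature.Probability.Percolation.DCT16
open Summit.CriticalPhenomena.PercolationContinuityZ3.Theorems.SurfaceTension
open scoped Literature.Probability.Percolation
open Filter Topology Literature.Probability.Percolation.DKT20

variable {d : ℕ}

/-- **Kesten's IIC exists under (A2)□ when `θ(p) = 0`** (`d ≥ 1`, `0 < p`). [cite: BasuSapozhnikov2017ECP, Thm. 1.1] [cite: Kesten1986, Thm. (3)] -/
theorem kestenIICExistsAt_of_setToSetQuasiMultAt (hd : 1 ≤ d) (p : unitInterval) (hp : 0 < (p : ℝ))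
    (hθ : theta (zdGraph d) 0 p = 0) {ϰ : ℝ} (hϰ : 0 < ϰ) (hA2 : SetToSetQuasiMultAt d p ϰ) : KestenIICExistsAt d p := by
  classical
  intro F E hEm hEF
  set μ := bondPercolation (zdGraph d) p with hμ
  -- (A2)□ with `ϰ₀ = min ϰ 1`, product form
  set ϰ₀ : ℝ := min ϰ 1 with hϰ₀
  have hϰ₀0 : 0 < ϰ₀ := lt_min hϰ one_pos
  have hϰ₀1 : ϰ₀ ≤ 1 := min_le_right _ _
  have hA2' : ∀ m : ℕ, 1 ≤ m → ∀ Z : Finset (Site d), box d (4 * m) \ box d (m - 1) ⊆ Z →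
      ∀ X : Finset (Site d), X ⊆ Z ∩ box d m → ∀ Y : Finset (Site d), Y ⊆ Z \ box d (4 * m) →
        ϰ₀ * (bondPercolation (zdGraph d) p).real {ω | ∃ x ∈ X, ∃ s ∈ innerBoundary (zdGraph d) (box d (2 * m)),
              ω ∈ openConnIn (↑Z : Set (Site d)) x s} *
          (bondPercolation (zdGraph d) p).real {ω | ∃ y ∈ Y, ∃ s ∈ innerBoundary (zdGraph d) (box d (2 * m)),
              ω ∈ openConnIn (↑Z : Set (Site d)) y s} ≤
        (bondPercolation (zdGraph d) p).real {ω | ∃ x ∈ X, ∃ y ∈ Y, ω ∈ openConnIn (↑Z : Set (Site d)) x y} := by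
    intro m hm Z hZ X hX Y hY
    have h := hA2 m hm Z hZ X hX Y hY
    rw [mul_assoc]
    exact (mul_le_mul_of_nonneg_right (min_le_left _ _) (mul_nonneg measureReal_nonneg measureReal_nonneg)).trans h
  obtain ⟨a₀, ha₀⟩ := exists_box_sym2_superset F
  -- the ratio sequence is Cauchy
  suffices hC : CauchySeq (fun n : ℕ => μ.real (E ∩ siteToBoundary d n) / oneArmProb d p n) from
    cauchySeq_tendsto_of_complete hC
  refine Metric.cauchySeq_iff'.2 fun δ hδ => ?_
  -- supersolution, junk size, scales
  have hK : (1 : ℝ) ≤ 1 / ϰ₀ ^ 2 := by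
    rw [le_div_iff₀ (by positivity), one_mul]; exact pow_le_one₀ hϰ₀0.le hϰ₀1
  obtain ⟨ε₀, hε₀0, hε₀1, L, hL, hQf⟩ := exists_kesten_supersolution_le hK (show 0 < δ / 4 by positivity)
  set ε : ℝ := min ε₀ (δ / 8) with hε
  have hεpos : 0 < ε := lt_min hε₀0 (by positivity)
  have hεε₀ : ε ≤ ε₀ := min_le_left _ _
  have hεδ : ε ≤ δ / 8 := min_le_right _ _
  have hε1 : ε < 1 := lt_of_le_of_lt hεε₀ hε₀1
  obtain ⟨Q, hQ1, hQ, hQL⟩ := hQf ε hεpos.le hεε₀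
  obtain ⟨M1, M2, μ1, μ2, hMs, hμs, ha₀M⟩ := exists_scheme_scales p hθ (show 0 < ϰ₀ ^ 2 * ε / 2 by positivity) a₀ L
  have hM' : ∀ l ≤ L, 1 ≤ M1 l ∧ 4 * M1 l < 2 * M2 l := fun l hl => ⟨(hMs l hl).1, (hMs l hl).2.1⟩
  have hμ' : ∀ l < L, 2 * (2 * M2 (l + 1) + 1) + 1 ≤ μ1 l ∧ 4 * μ1 l < 2 * μ2 l ∧ μ2 l ≤ M1 l :=
    fun l hl => ⟨(hμs l hl).1, (hμs l hl).2.1, (hμs l hl).2.2.1⟩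
  have hjunk' : ∀ l < L, μ.real (boxCrossing d (2 * μ1 l) (2 * μ2 l)) + μ.real (boxCrossing d (2 * M1 l) (2 * M2 l)) ≤ ϰ₀ ^ 2 * ε := by
    intro l hl
    have h1 := (hμs l hl).2.2.2
    have h2 := (hMs l hl.le).2.2
    linarith
  have hmono : ∀ l ≤ L, M2 l ≤ M2 0 := by
    intro l hl
    induction l with
    | zero => exact le_rfl
    | succ l ih =>
      have h1 := hμs l (by omega)
      have h2 := hMs l (by omega)
      have : M2 (l + 1) ≤ M2 l := by omega
      exact this.trans (ih (by omega))
  -- `1 ≤ Q L`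
  have hQge : ∀ l, 1 ≤ l → 1 ≤ Q l := by
    intro l hl
    induction l with
    | zero => omega
    | succ l ih =>
      rcases Nat.eq_zero_or_pos l with rfl | hl0
      · have h1e : (1 : ℝ) ≤ 1 / (1 - ε) ^ 2 := by
          rw [le_div_iff₀ (by nlinarith), one_mul]; nlinarith
        have hx : (0 : ℝ) ≤ 1 / ϰ₀ ^ 2 := by positivity
        have he : (1 - ε) ^ 2 ≤ 1 := by nlinarith
        calc (1 : ℝ) ≤ 1 / ϰ₀ ^ 2 := hK
          _ ≤ 1 / ϰ₀ ^ 2 / (1 - ε) ^ 2 := by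
              rw [le_div_iff₀ (by nlinarith)]; nlinarith [mul_le_mul_of_nonneg_left he hx]
          _ ≤ Q 1 := hQ1
      · have ih' := ih hl0
        have hstep := hQ l hl0
        have hKinv : 1 / (1 / ϰ₀ ^ 2) = ϰ₀ ^ 2 := by rw [one_div_one_div]
        rw [hKinv] at hstep
        have hϰ2 : ϰ₀ ^ 2 ≤ 1 := pow_le_one₀ hϰ₀0.le hϰ₀1
        have hnum : 1 ≤ ϰ₀ ^ 2 + (1 - ϰ₀ ^ 2) * Q l := by nlinarith
        have hden : 0 < (1 - ε) ^ 2 := by nlinarith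
        have hx0 : 0 ≤ ϰ₀ ^ 2 + (1 - ϰ₀ ^ 2) * Q l := by linarith
        have he : (1 - ε) ^ 2 ≤ 1 := by nlinarith
        have : ϰ₀ ^ 2 + (1 - ϰ₀ ^ 2) * Q l ≤ (ϰ₀ ^ 2 + (1 - ϰ₀ ^ 2) * Q l) / (1 - ε) ^ 2 := by
          rw [le_div_iff₀ hden]; nlinarith [mul_le_mul_of_nonneg_left he hx0]
        linarith
  refine ⟨4 * M2 0 + 1, fun n hn => ?_⟩
  -- the main estimate
  have main : ∀ n n' : ℕ, 4 * M2 0 < n' → n' ≤ n →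
      |μ.real (E ∩ siteToBoundary d n) / oneArmProb d p n - μ.real (E ∩ siteToBoundary d n') / oneArmProb d p n'| ≤ δ / 2 := by
    intro n n' hn' hnn'
    have hnL : 4 * M2 L < n' := lt_of_le_of_lt (Nat.mul_le_mul_left 4 (hmono L le_rfl)) hn'
    have hML := hM' L le_rfl
    have hE' : DeterminedBy E (↑((box d (2 * M1 L)).sym2) : Set (Sym2 (Site d))) :=
      hEF.mono (Finset.coe_subset.2 (ha₀.trans (Finset.sym2_mono (box_mono d ha₀M))))
    have hU' : DeterminedBy (Set.univ : Set (BondConfig (Site d))) (↑((box d (2 * M1 L)).sym2) : Set (Sym2 (Site d))) := by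
      rw [determinedBy_iff]; intro ω ω' _; simp
    obtain ⟨hSE1, hSE2⟩ := top_two_sided p hϰ₀0 hA2' (hM' L le_rfl).1 (hM' L le_rfl).2 (by omega : 4 * M2 L < n) hE' subset_rfl
    obtain ⟨hSE1', hSE2'⟩ := top_two_sided p hϰ₀0 hA2' (hM' L le_rfl).1 (hM' L le_rfl).2 hnL hE' subset_rfl
    obtain ⟨hSU1, hSU2⟩ := top_two_sided p hϰ₀0 hA2' (hM' L le_rfl).1 (hM' L le_rfl).2 (by omega : 4 * M2 L < n) hU' subset_rfl
    obtain ⟨hSU1', hSU2'⟩ := top_two_sided p hϰ₀0 hA2' (hM' L le_rfl).1 (hM' L le_rfl).2 hnL hU' subset_rfl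
    set 𝒟 := ((box d (2 * M2 L)).powerset.filter (fun U => box d (2 * M1 L) ⊆ U)) ×ˢ (box d (2 * M2 L + 1)).powerset with h𝒟
    set SEn := ∑ C ∈ 𝒟, (bondPercolation (zdGraph d) p).real (E ∩
          {ω : BondConfig (Site d) | ω ∩ (↑((box d (2 * M2 L + 1)).sym2) : Set (Sym2 (Site d))) ∈
            explEvent (↑(box d (2 * M1 L)) : Set (Site d)) ((↑(box d (2 * M2 L)) : Set (Site d)) \ ↑(box d (2 * M1 L))) ↑C.1 ↑C.2} ∩
          {ω : BondConfig (Site d) | ∀ r ∈ C.2, ∀ r' ∈ C.2, ∃ v ∈ C.1, ∃ v' ∈ C.1,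
            s(v, r) ∈ ω ∧ s(v', r') ∈ ω ∧ ω ∈ openConnIn ((↑C.1 : Set (Site d)) \ ↑(box d (2 * M1 L - 1))) v v'} ∩
          {ω : BondConfig (Site d) | ∃ x ∈ ({0} : Finset (Site d)), ∃ r ∈ C.2, ∃ v ∈ C.1, ω ∈ openConnIn ((↑C.1 : Set (Site d)) \ ↑(∅ : Finset (Site d))) x v ∧ s(v, r) ∈ ω}) * (bondPercolation (zdGraph d) p).real {ω : BondConfig (Site d) | ∃ x ∈ C.2, ∃ t ∈ innerBoundary (zdGraph d) (box d n),
            ω ∈ openConnIn ((↑(box d n) : Set (Site d)) \ ↑C.1) x t} with hSEn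
    set SEn' := ∑ C ∈ 𝒟, (bondPercolation (zdGraph d) p).real (E ∩
          {ω : BondConfig (Site d) | ω ∩ (↑((box d (2 * M2 L + 1)).sym2) : Set (Sym2 (Site d))) ∈
            explEvent (↑(box d (2 * M1 L)) : Set (Site d)) ((↑(box d (2 * M2 L)) : Set (Site d)) \ ↑(box d (2 * M1 L))) ↑C.1 ↑C.2} ∩
          {ω : BondConfig (Site d) | ∀ r ∈ C.2, ∀ r' ∈ C.2, ∃ v ∈ C.1, ∃ v' ∈ C.1,
            s(v, r) ∈ ω ∧ s(v', r') ∈ ω ∧ ω ∈ openConnIn ((↑C.1 : Set (Site d)) \ ↑(box d (2 * M1 L - 1))) v v'} ∩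
          {ω : BondConfig (Site d) | ∃ x ∈ ({0} : Finset (Site d)), ∃ r ∈ C.2, ∃ v ∈ C.1, ω ∈ openConnIn ((↑C.1 : Set (Site d)) \ ↑(∅ : Finset (Site d))) x v ∧ s(v, r) ∈ ω}) * (bondPercolation (zdGraph d) p).real {ω : BondConfig (Site d) | ∃ x ∈ C.2, ∃ t ∈ innerBoundary (zdGraph d) (box d n'),
            ω ∈ openConnIn ((↑(box d n') : Set (Site d)) \ ↑C.1) x t} with hSEn'
    set SUn := ∑ C ∈ 𝒟, (bondPercolation (zdGraph d) p).real (Set.univ ∩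
          {ω : BondConfig (Site d) | ω ∩ (↑((box d (2 * M2 L + 1)).sym2) : Set (Sym2 (Site d))) ∈
            explEvent (↑(box d (2 * M1 L)) : Set (Site d)) ((↑(box d (2 * M2 L)) : Set (Site d)) \ ↑(box d (2 * M1 L))) ↑C.1 ↑C.2} ∩
          {ω : BondConfig (Site d) | ∀ r ∈ C.2, ∀ r' ∈ C.2, ∃ v ∈ C.1, ∃ v' ∈ C.1,
            s(v, r) ∈ ω ∧ s(v', r') ∈ ω ∧ ω ∈ openConnIn ((↑C.1 : Set (Site d)) \ ↑(box d (2 * M1 L - 1))) v v'} ∩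
          {ω : BondConfig (Site d) | ∃ x ∈ ({0} : Finset (Site d)), ∃ r ∈ C.2, ∃ v ∈ C.1, ω ∈ openConnIn ((↑C.1 : Set (Site d)) \ ↑(∅ : Finset (Site d))) x v ∧ s(v, r) ∈ ω}) * (bondPercolation (zdGraph d) p).real {ω : BondConfig (Site d) | ∃ x ∈ C.2, ∃ t ∈ innerBoundary (zdGraph d) (box d n),
            ω ∈ openConnIn ((↑(box d n) : Set (Site d)) \ ↑C.1) x t} with hSUn
    set SUn' := ∑ C ∈ 𝒟, (bondPercolation (zdGraph d) p).real (Set.univ ∩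
          {ω : BondConfig (Site d) | ω ∩ (↑((box d (2 * M2 L + 1)).sym2) : Set (Sym2 (Site d))) ∈
            explEvent (↑(box d (2 * M1 L)) : Set (Site d)) ((↑(box d (2 * M2 L)) : Set (Site d)) \ ↑(box d (2 * M1 L))) ↑C.1 ↑C.2} ∩
          {ω : BondConfig (Site d) | ∀ r ∈ C.2, ∀ r' ∈ C.2, ∃ v ∈ C.1, ∃ v' ∈ C.1,
            s(v, r) ∈ ω ∧ s(v', r') ∈ ω ∧ ω ∈ openConnIn ((↑C.1 : Set (Site d)) \ ↑(box d (2 * M1 L - 1))) v v'} ∩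
          {ω : BondConfig (Site d) | ∃ x ∈ ({0} : Finset (Site d)), ∃ r ∈ C.2, ∃ v ∈ C.1, ω ∈ openConnIn ((↑C.1 : Set (Site d)) \ ↑(∅ : Finset (Site d))) x v ∧ s(v, r) ∈ ω}) * (bondPercolation (zdGraph d) p).real {ω : BondConfig (Site d) | ∃ x ∈ C.2, ∃ t ∈ innerBoundary (zdGraph d) (box d n'),
            ω ∈ openConnIn ((↑(box d n') : Set (Site d)) \ ↑C.1) x t} with hSUn'
    -- junk of the top level
    have hπn : 0 < oneArmProb d p n := oneArmProb_pos hd p hp n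
    have hπn' : 0 < oneArmProb d p n' := oneArmProb_pos hd p hp n'
    have hπeq : ∀ N : ℕ, μ.real (Set.univ ∩ siteToBoundary d N) = oneArmProb d p N := fun N => by
      rw [Set.univ_inter]; rfl
    rw [hπeq n] at hSU1 hSU2
    rw [hπeq n'] at hSU1' hSU2'
    have hη : ϰ₀⁻¹ ^ 2 * μ.real (boxCrossing d (2 * M1 L) (2 * M2 L)) ≤ ε := by
      have h2 := (hMs L le_rfl).2.2
      rw [inv_pow, inv_mul_le_iff₀ (by positivity : (0 : ℝ) < ϰ₀ ^ 2)]
      have : 0 ≤ ϰ₀ ^ 2 * ε := by positivity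
      linarith
    -- membership facts for the top data
    have hfacts : ∀ C ∈ 𝒟, C.1 ⊆ box d (2 * M2 L) ∧
        (bondPercolation (zdGraph d) p).real (Set.univ ∩
          {ω : BondConfig (Site d) | ω ∩ (↑((box d (2 * M2 L + 1)).sym2) : Set (Sym2 (Site d))) ∈
            explEvent (↑(box d (2 * M1 L)) : Set (Site d)) ((↑(box d (2 * M2 L)) : Set (Site d)) \ ↑(box d (2 * M1 L))) ↑C.1 ↑C.2} ∩
          {ω : BondConfig (Site d) | ∀ r ∈ C.2, ∀ r' ∈ C.2, ∃ v ∈ C.1, ∃ v' ∈ C.1,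
            s(v, r) ∈ ω ∧ s(v', r') ∈ ω ∧ ω ∈ openConnIn ((↑C.1 : Set (Site d)) \ ↑(box d (2 * M1 L - 1))) v v'} ∩
          {ω : BondConfig (Site d) | ∃ x ∈ ({0} : Finset (Site d)), ∃ r ∈ C.2, ∃ v ∈ C.1, ω ∈ openConnIn ((↑C.1 : Set (Site d)) \ ↑(∅ : Finset (Site d))) x v ∧ s(v, r) ∈ ω}) ≤ (bondPercolation (zdGraph d) p).real {ω : BondConfig (Site d) | ω ∩ (↑((box d (2 * M2 L + 1)).sym2) : Set (Sym2 (Site d))) ∈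
            explEvent (↑(box d (2 * M1 L)) : Set (Site d)) ((↑(box d (2 * M2 L)) : Set (Site d)) \ ↑(box d (2 * M1 L))) ↑C.1 ↑C.2} := by
      intro C hC
      rw [h𝒟, Finset.mem_product, Finset.mem_filter, Finset.mem_powerset] at hC
      exact ⟨hC.1.1, measureReal_mono (fun ω h => h.1.1.2) (measure_ne_top _ _)⟩
    have hwle : ∀ C ∈ 𝒟, (bondPercolation (zdGraph d) p).real (E ∩
          {ω : BondConfig (Site d) | ω ∩ (↑((box d (2 * M2 L + 1)).sym2) : Set (Sym2 (Site d))) ∈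
            explEvent (↑(box d (2 * M1 L)) : Set (Site d)) ((↑(box d (2 * M2 L)) : Set (Site d)) \ ↑(box d (2 * M1 L))) ↑C.1 ↑C.2} ∩
          {ω : BondConfig (Site d) | ∀ r ∈ C.2, ∀ r' ∈ C.2, ∃ v ∈ C.1, ∃ v' ∈ C.1,
            s(v, r) ∈ ω ∧ s(v', r') ∈ ω ∧ ω ∈ openConnIn ((↑C.1 : Set (Site d)) \ ↑(box d (2 * M1 L - 1))) v v'} ∩
          {ω : BondConfig (Site d) | ∃ x ∈ ({0} : Finset (Site d)), ∃ r ∈ C.2, ∃ v ∈ C.1, ω ∈ openConnIn ((↑C.1 : Set (Site d)) \ ↑(∅ : Finset (Site d))) x v ∧ s(v, r) ∈ ω}) ≤ (bondPercolation (zdGraph d) p).real (Set.univ ∩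
          {ω : BondConfig (Site d) | ω ∩ (↑((box d (2 * M2 L + 1)).sym2) : Set (Sym2 (Site d))) ∈
            explEvent (↑(box d (2 * M1 L)) : Set (Site d)) ((↑(box d (2 * M2 L)) : Set (Site d)) \ ↑(box d (2 * M1 L))) ↑C.1 ↑C.2} ∩
          {ω : BondConfig (Site d) | ∀ r ∈ C.2, ∀ r' ∈ C.2, ∃ v ∈ C.1, ∃ v' ∈ C.1,
            s(v, r) ∈ ω ∧ s(v', r') ∈ ω ∧ ω ∈ openConnIn ((↑C.1 : Set (Site d)) \ ↑(box d (2 * M1 L - 1))) v v'} ∩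
          {ω : BondConfig (Site d) | ∃ x ∈ ({0} : Finset (Site d)), ∃ r ∈ C.2, ∃ v ∈ C.1, ω ∈ openConnIn ((↑C.1 : Set (Site d)) \ ↑(∅ : Finset (Site d))) x v ∧ s(v, r) ∈ ω}) := fun C _ =>
      measureReal_mono (Set.inter_subset_inter_left _ (Set.inter_subset_inter_left _
        (Set.inter_subset_inter_left _ (Set.subset_univ E)))) (measure_ne_top _ _)
    -- the cross inequalities from the oscillation bound
    have hosc : ∀ C ∈ 𝒟, ∀ C' ∈ 𝒟, 0 < (bondPercolation (zdGraph d) p).real (Set.univ ∩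
          {ω : BondConfig (Site d) | ω ∩ (↑((box d (2 * M2 L + 1)).sym2) : Set (Sym2 (Site d))) ∈
            explEvent (↑(box d (2 * M1 L)) : Set (Site d)) ((↑(box d (2 * M2 L)) : Set (Site d)) \ ↑(box d (2 * M1 L))) ↑C.1 ↑C.2} ∩
          {ω : BondConfig (Site d) | ∀ r ∈ C.2, ∀ r' ∈ C.2, ∃ v ∈ C.1, ∃ v' ∈ C.1,
            s(v, r) ∈ ω ∧ s(v', r') ∈ ω ∧ ω ∈ openConnIn ((↑C.1 : Set (Site d)) \ ↑(box d (2 * M1 L - 1))) v v'} ∩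
          {ω : BondConfig (Site d) | ∃ x ∈ ({0} : Finset (Site d)), ∃ r ∈ C.2, ∃ v ∈ C.1, ω ∈ openConnIn ((↑C.1 : Set (Site d)) \ ↑(∅ : Finset (Site d))) x v ∧ s(v, r) ∈ ω}) →
        0 < (bondPercolation (zdGraph d) p).real (Set.univ ∩
          {ω : BondConfig (Site d) | ω ∩ (↑((box d (2 * M2 L + 1)).sym2) : Set (Sym2 (Site d))) ∈
            explEvent (↑(box d (2 * M1 L)) : Set (Site d)) ((↑(box d (2 * M2 L)) : Set (Site d)) \ ↑(box d (2 * M1 L))) ↑C'.1 ↑C'.2} ∩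
          {ω : BondConfig (Site d) | ∀ r ∈ C'.2, ∀ r' ∈ C'.2, ∃ v ∈ C'.1, ∃ v' ∈ C'.1,
            s(v, r) ∈ ω ∧ s(v', r') ∈ ω ∧ ω ∈ openConnIn ((↑C'.1 : Set (Site d)) \ ↑(box d (2 * M1 L - 1))) v v'} ∩
          {ω : BondConfig (Site d) | ∃ x ∈ ({0} : Finset (Site d)), ∃ r ∈ C'.2, ∃ v ∈ C'.1, ω ∈ openConnIn ((↑C'.1 : Set (Site d)) \ ↑(∅ : Finset (Site d))) x v ∧ s(v, r) ∈ ω}) →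
        0 < (bondPercolation (zdGraph d) p).real {ω : BondConfig (Site d) | ∃ x ∈ C.2, ∃ t ∈ innerBoundary (zdGraph d) (box d n),
            ω ∈ openConnIn ((↑(box d n) : Set (Site d)) \ ↑C.1) x t} → 0 < (bondPercolation (zdGraph d) p).real {ω : BondConfig (Site d) | ∃ x ∈ C'.2, ∃ t ∈ innerBoundary (zdGraph d) (box d n),
            ω ∈ openConnIn ((↑(box d n) : Set (Site d)) \ ↑C'.1) x t} →
        (bondPercolation (zdGraph d) p).real {ω : BondConfig (Site d) | ∃ x ∈ C.2, ∃ t ∈ innerBoundary (zdGraph d) (box d n),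
            ω ∈ openConnIn ((↑(box d n) : Set (Site d)) \ ↑C.1) x t} * (bondPercolation (zdGraph d) p).real {ω : BondConfig (Site d) | ∃ x ∈ C'.2, ∃ t ∈ innerBoundary (zdGraph d) (box d n'),
            ω ∈ openConnIn ((↑(box d n') : Set (Site d)) \ ↑C'.1) x t} ≤
          Q L * ((bondPercolation (zdGraph d) p).real {ω : BondConfig (Site d) | ∃ x ∈ C'.2, ∃ t ∈ innerBoundary (zdGraph d) (box d n),
            ω ∈ openConnIn ((↑(box d n) : Set (Site d)) \ ↑C'.1) x t} * (bondPercolation (zdGraph d) p).real {ω : BondConfig (Site d) | ∃ x ∈ C.2, ∃ t ∈ innerBoundary (zdGraph d) (box d n'),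
            ω ∈ openConnIn ((↑(box d n') : Set (Site d)) \ ↑C.1) x t}) := by
      intro C hC C' hC' hwC hwC' hγC hγC'
      exact conn_ratio_osc_le p hp hϰ₀0 hϰ₀1 hA2' hL hM' hμ' hjunk' hεpos.le hε1 Q hQ1 hQ hn' hnn' hC hC' hγC
        (lt_of_lt_of_le hwC (hfacts C hC).2) hγC' (lt_of_lt_of_le hwC' (hfacts C' hC').2)
    have htransfer : ∀ C ∈ 𝒟, 0 < (bondPercolation (zdGraph d) p).real {ω : BondConfig (Site d) | ∃ x ∈ C.2, ∃ t ∈ innerBoundary (zdGraph d) (box d n'),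
            ω ∈ openConnIn ((↑(box d n') : Set (Site d)) \ ↑C.1) x t} → 0 < (bondPercolation (zdGraph d) p).real {ω : BondConfig (Site d) | ∃ x ∈ C.2, ∃ t ∈ innerBoundary (zdGraph d) (box d n),
            ω ∈ openConnIn ((↑(box d n) : Set (Site d)) \ ↑C.1) x t} := fun C hC h =>
      real_conn_pos_of_real_conn_pos p hp (b := 2 * M2 L) (by omega) hnn' (hfacts C hC).1 h
    have hanti : ∀ C ∈ 𝒟, (bondPercolation (zdGraph d) p).real {ω : BondConfig (Site d) | ∃ x ∈ C.2, ∃ t ∈ innerBoundary (zdGraph d) (box d n),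
            ω ∈ openConnIn ((↑(box d n) : Set (Site d)) \ ↑C.1) x t} ≤ (bondPercolation (zdGraph d) p).real {ω : BondConfig (Site d) | ∃ x ∈ C.2, ∃ t ∈ innerBoundary (zdGraph d) (box d n'),
            ω ∈ openConnIn ((↑(box d n') : Set (Site d)) \ ↑C.1) x t} := by
      intro C hC
      rw [h𝒟, Finset.mem_product, Finset.mem_powerset] at hC
      exact real_conn_anti p (by omega) hnn' (hC.2.trans (box_mono d (by omega)))
    have hQ0 : 0 ≤ Q L := zero_le_one.trans (hQge L hL)
    have hx1 : SEn * SUn' ≤ Q L * (SEn' * SUn) :=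
      sum_mul_sum_le_of_osc 𝒟 (f := fun C => (bondPercolation (zdGraph d) p).real (E ∩
          {ω : BondConfig (Site d) | ω ∩ (↑((box d (2 * M2 L + 1)).sym2) : Set (Sym2 (Site d))) ∈
            explEvent (↑(box d (2 * M1 L)) : Set (Site d)) ((↑(box d (2 * M2 L)) : Set (Site d)) \ ↑(box d (2 * M1 L))) ↑C.1 ↑C.2} ∩
          {ω : BondConfig (Site d) | ∀ r ∈ C.2, ∀ r' ∈ C.2, ∃ v ∈ C.1, ∃ v' ∈ C.1,
            s(v, r) ∈ ω ∧ s(v', r') ∈ ω ∧ ω ∈ openConnIn ((↑C.1 : Set (Site d)) \ ↑(box d (2 * M1 L - 1))) v v'} ∩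
          {ω : BondConfig (Site d) | ∃ x ∈ ({0} : Finset (Site d)), ∃ r ∈ C.2, ∃ v ∈ C.1, ω ∈ openConnIn ((↑C.1 : Set (Site d)) \ ↑(∅ : Finset (Site d))) x v ∧ s(v, r) ∈ ω}))
        (g := fun C => (bondPercolation (zdGraph d) p).real (Set.univ ∩
          {ω : BondConfig (Site d) | ω ∩ (↑((box d (2 * M2 L + 1)).sym2) : Set (Sym2 (Site d))) ∈
            explEvent (↑(box d (2 * M1 L)) : Set (Site d)) ((↑(box d (2 * M2 L)) : Set (Site d)) \ ↑(box d (2 * M1 L))) ↑C.1 ↑C.2} ∩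
          {ω : BondConfig (Site d) | ∀ r ∈ C.2, ∀ r' ∈ C.2, ∃ v ∈ C.1, ∃ v' ∈ C.1,
            s(v, r) ∈ ω ∧ s(v', r') ∈ ω ∧ ω ∈ openConnIn ((↑C.1 : Set (Site d)) \ ↑(box d (2 * M1 L - 1))) v v'} ∩
          {ω : BondConfig (Site d) | ∃ x ∈ ({0} : Finset (Site d)), ∃ r ∈ C.2, ∃ v ∈ C.1, ω ∈ openConnIn ((↑C.1 : Set (Site d)) \ ↑(∅ : Finset (Site d))) x v ∧ s(v, r) ∈ ω}))
        (u := fun C => (bondPercolation (zdGraph d) p).real {ω : BondConfig (Site d) | ∃ x ∈ C.2, ∃ t ∈ innerBoundary (zdGraph d) (box d n),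
            ω ∈ openConnIn ((↑(box d n) : Set (Site d)) \ ↑C.1) x t})
        (v := fun C => (bondPercolation (zdGraph d) p).real {ω : BondConfig (Site d) | ∃ x ∈ C.2, ∃ t ∈ innerBoundary (zdGraph d) (box d n'),
            ω ∈ openConnIn ((↑(box d n') : Set (Site d)) \ ↑C.1) x t})
        hQ0 (fun C _ => measureReal_nonneg) hwle (fun C _ => measureReal_nonneg) (fun C _ => measureReal_nonneg)
        (fun C hC _ h => htransfer C hC h) hosc
    have hx2 : SEn' * SUn ≤ Q L * (SEn * SUn') :=
      sum_mul_sum_le_of_osc 𝒟 (f := fun C => (bondPercolation (zdGraph d) p).real (E ∩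
          {ω : BondConfig (Site d) | ω ∩ (↑((box d (2 * M2 L + 1)).sym2) : Set (Sym2 (Site d))) ∈
            explEvent (↑(box d (2 * M1 L)) : Set (Site d)) ((↑(box d (2 * M2 L)) : Set (Site d)) \ ↑(box d (2 * M1 L))) ↑C.1 ↑C.2} ∩
          {ω : BondConfig (Site d) | ∀ r ∈ C.2, ∀ r' ∈ C.2, ∃ v ∈ C.1, ∃ v' ∈ C.1,
            s(v, r) ∈ ω ∧ s(v', r') ∈ ω ∧ ω ∈ openConnIn ((↑C.1 : Set (Site d)) \ ↑(box d (2 * M1 L - 1))) v v'} ∩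
          {ω : BondConfig (Site d) | ∃ x ∈ ({0} : Finset (Site d)), ∃ r ∈ C.2, ∃ v ∈ C.1, ω ∈ openConnIn ((↑C.1 : Set (Site d)) \ ↑(∅ : Finset (Site d))) x v ∧ s(v, r) ∈ ω}))
        (g := fun C => (bondPercolation (zdGraph d) p).real (Set.univ ∩
          {ω : BondConfig (Site d) | ω ∩ (↑((box d (2 * M2 L + 1)).sym2) : Set (Sym2 (Site d))) ∈
            explEvent (↑(box d (2 * M1 L)) : Set (Site d)) ((↑(box d (2 * M2 L)) : Set (Site d)) \ ↑(box d (2 * M1 L))) ↑C.1 ↑C.2} ∩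
          {ω : BondConfig (Site d) | ∀ r ∈ C.2, ∀ r' ∈ C.2, ∃ v ∈ C.1, ∃ v' ∈ C.1,
            s(v, r) ∈ ω ∧ s(v', r') ∈ ω ∧ ω ∈ openConnIn ((↑C.1 : Set (Site d)) \ ↑(box d (2 * M1 L - 1))) v v'} ∩
          {ω : BondConfig (Site d) | ∃ x ∈ ({0} : Finset (Site d)), ∃ r ∈ C.2, ∃ v ∈ C.1, ω ∈ openConnIn ((↑C.1 : Set (Site d)) \ ↑(∅ : Finset (Site d))) x v ∧ s(v, r) ∈ ω}))
        (u := fun C => (bondPercolation (zdGraph d) p).real {ω : BondConfig (Site d) | ∃ x ∈ C.2, ∃ t ∈ innerBoundary (zdGraph d) (box d n'),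
            ω ∈ openConnIn ((↑(box d n') : Set (Site d)) \ ↑C.1) x t})
        (v := fun C => (bondPercolation (zdGraph d) p).real {ω : BondConfig (Site d) | ∃ x ∈ C.2, ∃ t ∈ innerBoundary (zdGraph d) (box d n),
            ω ∈ openConnIn ((↑(box d n) : Set (Site d)) \ ↑C.1) x t})
        hQ0 (fun C _ => measureReal_nonneg) hwle (fun C _ => measureReal_nonneg) (fun C _ => measureReal_nonneg)
        (fun C hC _ h => lt_of_lt_of_le h (hanti C hC))
        (fun C hC C' hC' hwC hwC' hγC hγC' => by
          have h := hosc C' hC' C hC hwC' hwC (htransfer C' hC' hγC') (htransfer C hC hγC)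
          linarith [mul_comm ((bondPercolation (zdGraph d) p).real {ω : BondConfig (Site d) | ∃ x ∈ C.2, ∃ t ∈ innerBoundary (zdGraph d) (box d n'),
            ω ∈ openConnIn ((↑(box d n') : Set (Site d)) \ ↑C.1) x t}) ((bondPercolation (zdGraph d) p).real {ω : BondConfig (Site d) | ∃ x ∈ C'.2, ∃ t ∈ innerBoundary (zdGraph d) (box d n),
            ω ∈ openConnIn ((↑(box d n) : Set (Site d)) \ ↑C'.1) x t}),
            mul_comm ((bondPercolation (zdGraph d) p).real {ω : BondConfig (Site d) | ∃ x ∈ C'.2, ∃ t ∈ innerBoundary (zdGraph d) (box d n'),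
            ω ∈ openConnIn ((↑(box d n') : Set (Site d)) \ ↑C'.1) x t}) ((bondPercolation (zdGraph d) p).real {ω : BondConfig (Site d) | ∃ x ∈ C.2, ∃ t ∈ innerBoundary (zdGraph d) (box d n),
            ω ∈ openConnIn ((↑(box d n) : Set (Site d)) \ ↑C.1) x t})])
    -- sums comparisons
    have hSS : SEn ≤ SUn := Finset.sum_le_sum fun C hC => mul_le_mul_of_nonneg_right (hwle C hC) measureReal_nonneg
    have hSS' : SEn' ≤ SUn' := Finset.sum_le_sum fun C hC => mul_le_mul_of_nonneg_right (hwle C hC) measureReal_nonneg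
    have h0S : 0 ≤ SEn := Finset.sum_nonneg fun C _ => mul_nonneg measureReal_nonneg measureReal_nonneg
    have h0S' : 0 ≤ SEn' := Finset.sum_nonneg fun C _ => mul_nonneg measureReal_nonneg measureReal_nonneg
    have hjn : ϰ₀⁻¹ ^ 2 * μ.real (boxCrossing d (2 * M1 L) (2 * M2 L)) * oneArmProb d p n ≤ ε * oneArmProb d p n :=
      mul_le_mul_of_nonneg_right hη hπn.le
    have hjn' : ϰ₀⁻¹ ^ 2 * μ.real (boxCrossing d (2 * M1 L) (2 * M2 L)) * oneArmProb d p n' ≤ ε * oneArmProb d p n' :=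
      mul_le_mul_of_nonneg_right hη hπn'.le
    have key := abs_div_sub_div_le_of_two_sided (V := μ.real (E ∩ siteToBoundary d n)) (V' := μ.real (E ∩ siteToBoundary d n'))
      (S := SEn) (S' := SEn') (T := SUn) (T' := SUn') hπn hπn' hεpos.le hε1 (hQge L hL)
      ⟨hSU1, hSU2.trans (by linarith)⟩ ⟨hSU1', hSU2'.trans (by linarith)⟩ ⟨hSE1, hSE2.trans (by linarith)⟩
      ⟨hSE1', hSE2'.trans (by linarith)⟩ h0S hSS h0S' hSS' hx1 hx2
    linarith
  have h := main n (4 * M2 0 + 1) (by omega) hn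
  rw [Real.dist_eq]
  linarith

/-- **Kesten's IIC exists at `p_c(ℤ^d)` under (A2)□** (`d ≥ 2`; `θ(p_c) = 0` by `CSH.percolationContinuity_allDimensions`):
Basu–Sapozhnikov's Theorem 1.1 at criticality in box form. [cite: BasuSapozhnikov2017ECP, Thm. 1.1] [cite: Kesten1986, Thm. (3)] -/
theorem kestenIICExistsAt_criticalProbI_of_setToSetQuasiMultAt (hd : 2 ≤ d) {ϰ : ℝ} (hϰ : 0 < ϰ)
    (hA2 : SetToSetQuasiMultAt d (criticalProbI d) ϰ) : KestenIICExistsAt d (criticalProbI d) := by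
  have hpc : 0 < ((criticalProbI d : unitInterval) : ℝ) := by
    have h := Literature.Barriers.CriticalPhenomena.criticalProbI_pos' (d := d) (by omega)
    exact_mod_cast h
  exact kestenIICExistsAt_of_setToSetQuasiMultAt (by omega) (criticalProbI d) hpc (CSH.percolationContinuity_allDimensions d hd) hϰ hA2


end Summit.CriticalPhenomena.PercolationContinuityZ3.Theorems.Crossing

end
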